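import Summits.ValiantsHypothesis.ValiantsHypothesis.Theorems.SymPencilPerFourOneRowToricProd
import Summits.ValiantsHypothesis.ValiantsHypothesis.Theorems.SymPencilPerFourOneRowProductR1N

/-!
# Route `SymPencil` — leaf R1N of the `(11, 5, 4)` cascade: the TORIC branch in general position
# (`--supports` stmt-ValiantsHypothesis-5674 `SdcSuperquadratic`; memo `SING-FIVE-CLASSIFICATION.md` §6.6; closes the conjunct
# `R1NToric K` of the residual `stub_R1N_residual` of `Cruxes/SdcSuperquadratic/Lines/sing_five_classification.lean` (rev 10) —
# its statement below is that conjunct with `PerDirFour W` unfolded; rung currency only)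

`r1nToric`: `W ⊆ K^{4×4}` singular, `dim W = 5`, zero row `3`, no zero column, `¬ TwoZeroRows`, a per-direction family of
`≤ 4` squares at every `y ∈ W`, and every row of rank `≤ 2` — impossible.  Proof: the live rows `0, 1, 2` have ranks
`n_r ∈ {1, 2}` with `n₀ + n₁ + n₂ ≥ 5` (`W ↪ A₀ × A₁ × A₂`), so the rank vector is `(2,2,2)` or a permutation of `(2,2,1)`;
`toric_absurd_of_perm` transports by a row relabelling `biPermL ρ 1` (`ρ 0 = 3`) to the normal position (zero row `0`) of
✓ `toric_hyp_absurd` / ✓ `toric_prod_absurd`.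

Honest framing: [folklore] transport for ONE leaf of ONE of four open size-27 cells; the cell file remains OPEN until the workfile's
`stub_R1N_residual` is replaced by `⟨r1nToric, r1nProduct⟩`; `27 ≤ sdc(per₄) ≤ 29` unchanged; the crux `SdcSuperquadratic` and
`VP ≠ VNP` untouched; no summit statement is proved here.  No definitions, no named facts.
-/

noncomputable section

set_option linter.dupNamespace false

namespace Summit.ValiantsHypothesis.ValiantsHypothesis.Theorems.SymPencilPerFourOneRowToric

open Module MvPolynomial
open Literature.Computability.AlgebraicComplexity
open Summit.ValiantsHypothesis.ValiantsHypothesis.Theorems.SymPencilSingSixClassification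
open Summit.ValiantsHypothesis.ValiantsHypothesis.Theorems.SymPencilPerFourOneRowKernelPlane
open Summit.ValiantsHypothesis.ValiantsHypothesis.Theorems.SymPencilPerFourOneRowReading
open Summit.ValiantsHypothesis.ValiantsHypothesis.Theorems.SymPencilPerFourTwoRowCorankTwo
open Summit.ValiantsHypothesis.ValiantsHypothesis.Theorems.SymPencilPerFourOneRowProduct

variable {K : Type*} [Field K]

/-- **Transport to the normal position.**  For a row relabelling `ρ` with `ρ 0 = 3` (the zero row), the rows `ρ 1, ρ 2` of
rank `2` and the row `ρ 3` of rank `2` or `1`, the space `W.map (biPermL ρ 1)` is in the normal position of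
✓ `toric_hyp_absurd` / ✓ `toric_prod_absurd`. [folklore] -/
theorem toric_absurd_of_perm [CharZero K] {W : Submodule K (Fin 4 × Fin 4 → K)} (hS : Sing3 W)
    (h5 : finrank K W = 5) (hrow : ∀ x ∈ W, ∀ j : Fin 4, x (3, j) = 0)
    (hncol : ¬ (∃ j : Fin 4, ∀ x ∈ W, ∀ i : Fin 4, x (i, j) = 0))
    (hP : ∀ y ∈ W, ∃ (c : Fin 4 → K) (Λ : Fin 4 → ((Fin 4 × Fin 4 → K) →ₗ[K] K)),
      ∀ u : Fin 4 × Fin 4 → K, ∃ e₀ e₁ : K, ∀ s : K,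
        eval (u + s • y) (perPoly (Fin 4) K) = e₀ + s * e₁ + s ^ 2 * ∑ k, c k * (Λ k u) ^ 2)
    (ρ : Equiv.Perm (Fin 4)) (hρ0 : ρ 0 = 3) (h1 : finrank K (W.map (rowL (K := K) (ρ 1))) = 2)
    (h2 : finrank K (W.map (rowL (K := K) (ρ 2))) = 2)
    (h3 : finrank K (W.map (rowL (K := K) (ρ 3))) = 2 ∨ finrank K (W.map (rowL (K := K) (ρ 3))) = 1) : False := by
  classical
  set Φ : (Fin 4 × Fin 4 → K) ≃ₗ[K] (Fin 4 × Fin 4 → K) := biPermL ρ 1 with hΦ_def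
  have hΦper : ∀ z, eval (Φ z) (perPoly (Fin 4) K) = eval z (perPoly (Fin 4) K) := fun z => by
    have hz : (Φ z : Fin 4 × Fin 4 → K) = z ∘ (Equiv.prodCongr ρ (1 : Equiv.Perm (Fin 4))) := rfl
    rw [hz, SymPencilPerFourBlocks.eval_perPoly_comp_prodCongr]
  set W' : Submodule K (Fin 4 × Fin 4 → K) :=
    W.map (Φ : (Fin 4 × Fin 4 → K) →ₗ[K] (Fin 4 × Fin 4 → K)) with hW'_def
  have hS' : Sing3 W' := sing3_map_biPermL hS ρ 1
  have h5' : finrank K W' = 5 := by rw [hW'_def, LinearEquiv.finrank_map_eq, h5]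
  have hi' : ∀ y ∈ W', row y 0 = 0 := by
    rintro _ ⟨x, hx, rfl⟩
    funext m
    show x (ρ 0, m) = 0
    rw [hρ0]
    exact hrow x hx m
  have hcol' : ∀ m : Fin 4, ∃ y ∈ W', ∃ i : Fin 4, y (i, m) ≠ 0 := by
    intro m
    by_contra hne
    push Not at hne
    refine hncol ⟨m, fun x hx i => ?_⟩
    have h : x (ρ (ρ.symm i), m) = 0 := hne (Φ x) (Submodule.mem_map_of_mem hx) (ρ.symm i)
    rwa [Equiv.apply_symm_apply] at h
  have hfam : ∀ y ∈ W', ∃ (c : Fin 4 → K) (Λ : Fin 4 → ((Fin 4 × Fin 4 → K) →ₗ[K] K)),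
      ∀ u : Fin 4 × Fin 4 → K, ∃ e₀ e₁ : K, ∀ s : K,
        eval (u + s • y) (perPoly (Fin 4) K) = e₀ + s * e₁ + s ^ 2 * ∑ k, c k * (Λ k u) ^ 2 := by
    rintro _ ⟨x, hx, rfl⟩
    obtain ⟨c₀, Λ, h⟩ := hP x hx
    exact ⟨c₀, fun k => (Λ k).comp Φ.symm.toLinearMap, sum_sq_swap_map Φ hΦper x c₀ Λ h⟩
  have hrank : ∀ x : Fin 4, W'.map (rowL (K := K) x) = W.map (rowL (K := K) (ρ x)) := by
    intro x
    rw [hW'_def, ← Submodule.map_comp]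
    congr 1
  rcases h3 with h3 | h3
  · exact toric_hyp_absurd hS' h5' hi' hcol' (by rw [hrank]; exact h1) (by rw [hrank]; exact h2)
      (by rw [hrank]; exact h3)
  · exact toric_prod_absurd hS' h5' hi' hcol' hfam (by rw [hrank]; exact h1) (by rw [hrank]; exact h2)
      (by rw [hrank]; exact h3)

/-- **§6.6 in general position — the conjunct `R1NToric K` of the R1N residual.**  See the module docstring. [folklore] -/
theorem r1nToric [CharZero K] (W : Submodule K (Fin 4 × Fin 4 → K)) (hS : Sing3 W)
    (h5 : finrank K W = 5) (hrow : ∀ x ∈ W, ∀ j : Fin 4, x (3, j) = 0)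
    (hncol : ¬ (∃ j : Fin 4, ∀ x ∈ W, ∀ i : Fin 4, x (i, j) = 0))
    (hn2 : ¬ TwoZeroRows W) (_hnX : ¬ InCross W)
    (hP : ∀ y ∈ W, ∃ (c : Fin 4 → K) (Λ : Fin 4 → ((Fin 4 × Fin 4 → K) →ₗ[K] K)),
      ∀ u : Fin 4 × Fin 4 → K, ∃ e₀ e₁ : K, ∀ s : K,
        eval (u + s • y) (perPoly (Fin 4) K) = e₀ + s * e₁ + s ^ 2 * ∑ k, c k * (Λ k u) ^ 2)
    (hle : ∀ r : Fin 4, finrank K (W.map (rowL (K := K) r)) ≤ 2) : False := by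
  classical
  -- every live row has rank `≥ 1`
  have hpos : ∀ r : Fin 4, r ≠ 3 → 1 ≤ finrank K (W.map (rowL (K := K) r)) := by
    intro r hr3
    by_contra hlt
    have h0 : W.map (rowL (K := K) r) = ⊥ := by
      rw [← Submodule.finrank_eq_zero]
      omega
    refine hn2 ⟨r, 3, hr3, fun x hx j => ⟨?_, hrow x hx j⟩⟩
    have hx' : rowL (K := K) r x ∈ W.map (rowL (K := K) r) := Submodule.mem_map_of_mem hx
    rw [h0, Submodule.mem_bot] at hx'
    exact congr_fun hx' j
  -- `dim W ≤ n₀ + n₁ + n₂`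
  have hsum : 5 ≤ finrank K (W.map (rowL (K := K) 0)) + finrank K (W.map (rowL (K := K) 1)) +
      finrank K (W.map (rowL (K := K) 2)) := by
    have c1 := finrank_kernel_add W 0
    have c2 := finrank_kernel_add (W ⊓ LinearMap.ker (rowL 0)) 1
    have c3 := finrank_kernel_add (W ⊓ LinearMap.ker (rowL 0) ⊓ LinearMap.ker (rowL 1)) 2
    have m2 : finrank K ((W ⊓ LinearMap.ker (rowL 0)).map (rowL (K := K) 1)) ≤
        finrank K (W.map (rowL (K := K) 1)) := Submodule.finrank_mono (Submodule.map_mono inf_le_left)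
    have m3 : finrank K ((W ⊓ LinearMap.ker (rowL 0) ⊓ LinearMap.ker (rowL 1)).map (rowL (K := K) 2)) ≤
        finrank K (W.map (rowL (K := K) 2)) :=
      Submodule.finrank_mono (Submodule.map_mono (inf_le_left.trans inf_le_left))
    have m4 : finrank K ↥(W ⊓ LinearMap.ker (rowL 0) ⊓ LinearMap.ker (rowL 1) ⊓ LinearMap.ker (rowL 2)) = 0 := by
      rw [Submodule.finrank_eq_zero, eq_bot_iff]
      intro y hy
      rw [Submodule.mem_bot]
      have hy2 := (Submodule.mem_inf.1 hy).2
      have hy01 := (Submodule.mem_inf.1 hy).1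
      have hy1 := (Submodule.mem_inf.1 hy01).2
      have hyW0 := (Submodule.mem_inf.1 hy01).1
      have hy0 := (Submodule.mem_inf.1 hyW0).2
      have hyW := (Submodule.mem_inf.1 hyW0).1
      rw [LinearMap.mem_ker, rowL_apply] at hy0 hy1 hy2
      funext ⟨i, j⟩
      fin_cases i
      · exact congr_fun hy0 j
      · exact congr_fun hy1 j
      · exact congr_fun hy2 j
      · exact hrow y hyW j
    omega
  have e0 := hle 0; have e1 := hle 1; have e2 := hle 2
  have p0 := hpos 0 (by decide); have p1 := hpos 1 (by decide); have p2 := hpos 2 (by decide)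
  -- the rank vector is `(2,2,2)` or a permutation of `(2,2,1)`
  by_cases hn0 : finrank K (W.map (rowL (K := K) 0)) = 2
  · by_cases hn1 : finrank K (W.map (rowL (K := K) 1)) = 2
    · -- `(2, 2, n₂)`, `ρ = (3, 0, 1, 2)`
      obtain ⟨ρ, hρ0, hρ1, hρ2, hρ3⟩ := exists_perm_three_rst 0 1 2 (by decide) (by decide) (by decide)
        (by decide) (by decide) (by decide)
      exact toric_absurd_of_perm hS h5 hrow hncol hP ρ hρ0 (by rw [hρ1]; exact hn0) (by rw [hρ2]; exact hn1)
        (by rw [hρ3]; omega)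
    · -- `(2, 1, 2)`, `ρ = (3, 0, 2, 1)`
      obtain ⟨ρ, hρ0, hρ1, hρ2, hρ3⟩ := exists_perm_three_rst 0 2 1 (by decide) (by decide) (by decide)
        (by decide) (by decide) (by decide)
      exact toric_absurd_of_perm hS h5 hrow hncol hP ρ hρ0 (by rw [hρ1]; exact hn0) (by rw [hρ2]; omega)
        (by rw [hρ3]; omega)
  · -- `(1, 2, 2)`, `ρ = (3, 1, 2, 0)`
    obtain ⟨ρ, hρ0, hρ1, hρ2, hρ3⟩ := exists_perm_three_rst 1 2 0 (by decide) (by decide) (by decide)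
      (by decide) (by decide) (by decide)
    exact toric_absurd_of_perm hS h5 hrow hncol hP ρ hρ0 (by rw [hρ1]; omega) (by rw [hρ2]; omega)
      (by rw [hρ3]; omega)

end Summit.ValiantsHypothesis.ValiantsHypothesis.Theorems.SymPencilPerFourOneRowToric
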